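import Literature.AlgebraicGeometry.Morphisms.FormalFunctions
import HarnessLib

/-!
# Global functions on a proper integral scheme with a rational point: `Γ(X, 𝒪_X) = K`

Topic `Literature/AlgebraicGeometry/Morphisms`; namespace `Literature.AlgebraicGeometry.Morphisms`.  THEOREMS ONLY (no
definition, no named fact, no instance; net Literature debt 0).  Cell `hodgecm-mathlib` (D-0151), fan B-III (T1) road W
for `r₀`, (W0) leaf Lβ of B-p18's W0-SPEC (the «ω-argument»: an everywhere-regular function on the proper integral
`K`-variety underlying an abelian variety is constant — used to normalise invariant differentials / units).

* `bijective_algebraMapΓ_of_universallyClosed_of_section` — for a field `K`, an integral scheme `X` universally closed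
  over `Spec K` (e.g. proper, Mathlib instance) admitting a section `σ : Spec K → X`, the structure map
  `K → Γ(X, 𝒪_X)` (the tree's `Morphisms.algebraMapΓ`) is BIJECTIVE ([Hartshorne1977] II Ex. 4.5(d), III §12; Stacks 0BUG:
  `Γ(X, 𝒪_X)` is a domain integral over `K`, hence a field — Mathlib `isField_of_universallyClosed` — and `σ^*` is a
  retraction of the structure map, injective on that field);
* `eq_algebraMapΓ_section_appTop` — the resulting formula `s = algebraMapΓ f (σ^* s)`: every global function is the
  constant given by its value at the rational point.

HC_CM is proved only modulo the 7 printed citations until rung 0 closes.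

## References
* [Hartshorne1977] R. Hartshorne, *Algebraic Geometry*, GTM 52: II Ex. 4.5(d); III Thm. 12.11 (setting `f_* 𝒪_X = 𝒪_Y`).
* The Stacks project, Tag 0BUG (global sections of proper varieties).
-/

set_option autoImplicit false

noncomputable section

open CategoryTheory AlgebraicGeometry Limits

universe u

namespace Literature.AlgebraicGeometry.Morphisms

/-- **`Γ(X, 𝒪_X) = K` for a proper integral `K`-scheme with a `K`-point** ([Hartshorne1977] II Ex. 4.5(d) / III.12 setting;
Stacks 0BUG): for a field `K`, an integral scheme `X` universally closed over `Spec K` (e.g. proper) and a section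
`σ : Spec K → X` of the structure morphism, the structure map `K → Γ(X, 𝒪_X)` is bijective — `Γ(X, 𝒪_X)` is a domain
integral over `K`, hence a field (Mathlib `isField_of_universallyClosed`), and `σ*` is a retraction of it.
[cite: Hartshorne1977, II Ex. 4.5(d) and III Thm. 12.11 setting; Stacks 0BUG] -/
theorem bijective_algebraMapΓ_of_universallyClosed_of_section {K : Type u} [Field K] {X : Scheme.{u}}
    (f : X ⟶ Spec (.of K)) [IsIntegral X] [UniversallyClosed f] (σ : Spec (.of K) ⟶ X) (hσ : σ ≫ f = 𝟙 _) :
    Function.Bijective (algebraMapΓ f) := by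
  -- the retraction `ρ = σ^* : Γ(X, 𝒪_X) → K`
  let ρ : Γ(X, ⊤) →+* K := (Scheme.ΓSpecIso (.of K)).hom.hom.comp σ.appTop.hom
  have h1 : f.appTop ≫ σ.appTop = 𝟙 _ := by
    rw [← Scheme.Hom.comp_appTop, hσ, Scheme.Hom.id_appTop]
  have hρ : ρ.comp (algebraMapΓ f) = RingHom.id K := by
    refine RingHom.ext fun a => ?_
    change (Scheme.ΓSpecIso _).hom.hom ((f.appTop ≫ σ.appTop).hom ((Scheme.ΓSpecIso _).inv.hom a)) = a
    rw [h1]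
    exact (Scheme.ΓSpecIso (.of K)).inv_hom_id_apply a
  refine ⟨fun a b hab => ?_, fun s => ⟨ρ s, ?_⟩⟩
  · have := congr(ρ $hab)
    rwa [← RingHom.comp_apply, ← RingHom.comp_apply, hρ] at this
  · -- `Γ(X, 𝒪_X)` is a field, so the ring map `ρ` out of it has trivial kernel
    have hF : IsField Γ(X, ⊤) := isField_of_universallyClosed K f
    have hx : ρ (s - algebraMapΓ f (ρ s)) = 0 := by
      rw [map_sub, ← RingHom.comp_apply, hρ, RingHom.id_apply, sub_self]
    by_contra hne
    have hne' : s - algebraMapΓ f (ρ s) ≠ 0 := fun h => hne (sub_eq_zero.mp h).symm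
    obtain ⟨y, hy⟩ := hF.mul_inv_cancel hne'
    have := congr(ρ $hy)
    rw [map_mul, hx, zero_mul, map_one] at this
    exact zero_ne_one this

/-- **Every global function on a proper integral `K`-scheme with a `K`-point `σ` is the constant `σ^*(s)`**:
`s = algebraMapΓ f ((ΓSpecIso K) (σ^* s))` ([Hartshorne1977] II Ex. 4.5(d); Stacks 0BUG).
[cite: Hartshorne1977, II Ex. 4.5(d); Stacks 0BUG] -/
theorem eq_algebraMapΓ_section_appTop {K : Type u} [Field K] {X : Scheme.{u}}
    (f : X ⟶ Spec (.of K)) [IsIntegral X] [UniversallyClosed f] (σ : Spec (.of K) ⟶ X) (hσ : σ ≫ f = 𝟙 _)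
    (s : Γ(X, ⊤)) :
    s = algebraMapΓ f ((Scheme.ΓSpecIso (.of K)).hom.hom (σ.appTop.hom s)) := by
  obtain ⟨a, rfl⟩ := (bijective_algebraMapΓ_of_universallyClosed_of_section f σ hσ).2 s
  have h1 : f.appTop ≫ σ.appTop = 𝟙 _ := by
    rw [← Scheme.Hom.comp_appTop, hσ, Scheme.Hom.id_appTop]
  congr 1
  change a = (Scheme.ΓSpecIso _).hom.hom ((f.appTop ≫ σ.appTop).hom ((Scheme.ΓSpecIso _).inv.hom a))
  rw [h1]
  exact ((Scheme.ΓSpecIso (.of K)).inv_hom_id_apply a).symm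

end Literature.AlgebraicGeometry.Morphisms

end
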